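import Summits.NavierStokesRegularity.NavierStokesRegularity.Theorems.QuantisedSymmetryPolyhedralDssProfileExistsStubBlowupTrace
import Literature.Analysis.FluidPDE.TaoEnstrophyLocalisation
import HarnessLib

/-!
# The scar is `C¹` off the origin — crux stmt-NavierStokesRegularity-1404
  (`QuantisedSymmetry.PolyhedralDssProfileExists`), line polyhedral_cell, stub stub_traceC1 (N29)

Registered stub `stub_traceC1` (`--supports stmt-NavierStokesRegularity-1404`): for a Type-I
ancient mild field `V` in the Oseen gauge (`IsTypeIAncientMild C V`) with `HasTypeIDecay C₀ V` and
pointwise blow-up-time trace `V₀` off the origin (stub N18, `stub_blowupTrace`), the trace is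
differentiable on `ℝ³ ∖ {0}` with continuous derivative there, the GRADIENTS `DV(t,x)` (hence the
vorticities `curl V(t,x)`) converge to `DV₀(x)` (`curl V₀(x)`) as `t ↑ 0` for every `x ≠ 0`, and
`‖x‖² ‖DV₀(x)‖ ≤ K`.

Proof sketch (no Arzelà–Ascoli). Pineau–Vicol 2026, Lemma 7.1 in physical variables
(`PineauVicol2026.exists_forall_iteratedFDeriv_le_of_typeI`, `n = 1, 2`, fed with the classical
pressure of `exists_isClassicalNSSolutionOn_Iio_of_isTypeIAncientMild`) bounds `‖DV(t)‖ ≤ K₁ρ⁻²` and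
`‖D²V(t)‖ ≤ M = K₂ρ⁻³` on `B = ball x₀ ρ`, `ρ = ‖x₀‖/2`, uniformly in `t < 0` (`traceC1_local`).
Hence the second-order Taylor estimate `‖V(t,x₀+h) − V(t,x₀) − DV(t,x₀)h‖ ≤ M‖h‖²` (mean value
inequality along the segment for `y ↦ V(t,y) − DV(t,x₀)y`, `traceC1_taylor`) and the `M`-Lipschitz
bound for `DV(t)` on `B`. Testing the Taylor estimate at `h = δeᵢ` for the three basis vectors,
`δ‖(DV(t,x₀) − DV(t',x₀))eᵢ‖ ≤ ‖V(t,x₀+δeᵢ) − V(t',x₀+δeᵢ)‖ + ‖V(t,x₀) − V(t',x₀)‖ + 2Mδ²`, so the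
pointwise convergence of `V` at the four points `x₀, x₀ + δeᵢ` makes `DV(t,x₀)` Cauchy in operator
norm (`‖A‖ ≤ ∑ᵢ ‖Aeᵢ‖`, `traceC1_opNorm_le_sum`), hence convergent to some `L(x₀)`; passing to the
limit in the Taylor estimate gives `‖V₀(x₀+h) − V₀(x₀) − L(x₀)h‖ ≤ M‖h‖²`, i.e.
`HasFDerivAt V₀ (L x₀) x₀` (`traceC1_tendsto_fderiv`). The Lipschitz bound passes to the limit, so
`DV₀ = L` is continuous off `0`; `curl = curlCLM ∘ D` is a continuous linear function of the
gradient; and `‖DV(t,x)‖ ≤ K₁ max(‖x‖,√(−t))⁻² ≤ K₁‖x‖⁻²` passes to the limit.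
-/

noncomputable section

-- the summit namespace `…NavierStokesRegularity.NavierStokesRegularity…` is the tree convention (D-0017)
set_option linter.dupNamespace false

namespace Summit.NavierStokesRegularity.NavierStokesRegularity.Theorems.PolyhedralDssProfileExists.PolyhedralCell

open MeasureTheory Set Function Filter Topology Metric
open Literature.Analysis Literature.Analysis.FluidPDE
open scoped InnerProductSpace RealInnerProductSpace

section Calculus

variable {F G : Type*} [NormedAddCommGroup F] [NormedSpace ℝ F] [NormedAddCommGroup G]
  [NormedSpace ℝ G] {f : F → G} {s : Set F} {M : ℝ} {x z : F}

/-- Mean value inequality for the gradient: a bound `‖D²f‖ ≤ M` on a convex set makes `Df`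
`M`-Lipschitz there. -/
theorem traceC1_norm_fderiv_sub_le (hs : Convex ℝ s) (hf : ContDiff ℝ 2 f)
    (hM : ∀ y ∈ s, ‖iteratedFDeriv ℝ 2 f y‖ ≤ M) (hx : x ∈ s) (hz : z ∈ s) :
    ‖fderiv ℝ f z - fderiv ℝ f x‖ ≤ M * ‖z - x‖ := by
  refine hs.norm_image_sub_le_of_norm_fderiv_le (𝕜 := ℝ) (f := fderiv ℝ f)
    (fun y _ => ((hf.fderiv_right (m := 1) (one_add_one_eq_two).le).differentiable one_ne_zero) y)
    (fun y hy => ?_) hx hz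
  rw [← norm_iteratedFDeriv_zero (𝕜 := ℝ) (f := fderiv ℝ (fderiv ℝ f)), norm_iteratedFDeriv_fderiv,
    norm_iteratedFDeriv_fderiv]
  exact hM y hy

/-- Second-order Taylor estimate on a convex set: `‖f z − f x − Df(x)(z − x)‖ ≤ M‖z − x‖²` when
`‖D²f‖ ≤ M` there (mean value inequality for `y ↦ f y − Df(x) y` along the segment `[x, z]`, on
which `‖Df(y) − Df(x)‖ ≤ M‖y − x‖ ≤ M‖z − x‖`). -/
theorem traceC1_taylor (hs : Convex ℝ s) (hf : ContDiff ℝ 2 f)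
    (hM : ∀ y ∈ s, ‖iteratedFDeriv ℝ 2 f y‖ ≤ M) (hx : x ∈ s) (hz : z ∈ s) :
    ‖f z - f x - fderiv ℝ f x (z - x)‖ ≤ M * ‖z - x‖ ^ 2 := by
  have hM0 : 0 ≤ M := (norm_nonneg _).trans (hM x hx)
  have key : ∀ y ∈ segment ℝ x z, ‖fderiv ℝ f y - fderiv ℝ f x‖ ≤ M * ‖z - x‖ := fun y hy => by
    refine (traceC1_norm_fderiv_sub_le hs hf hM hx (hs.segment_subset hx hz hy)).trans ?_
    have h2 : dist y x ≤ dist z x := by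
      have h := dist_add_dist_of_mem_segment hy
      linarith [dist_nonneg (x := y) (y := z), dist_comm x y, dist_comm x z]
    rw [dist_eq_norm, dist_eq_norm] at h2
    exact mul_le_mul_of_nonneg_left h2 hM0
  have h := (convex_segment x z).norm_image_sub_le_of_norm_fderiv_le' (𝕜 := ℝ)
    (fun y _ => (hf.differentiable two_ne_zero) y) key
    (left_mem_segment ℝ x z) (right_mem_segment ℝ x z)
  simpa only [sq, mul_assoc] using h

/-- A continuous linear map on `ℝ³` is controlled by its values on the standard basis:
`‖A‖ ≤ ∑ᵢ ‖A eᵢ‖` (expand `v = ∑ vᵢ eᵢ` and use `|vᵢ| ≤ ‖v‖`). -/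
theorem traceC1_opNorm_le_sum (A : EuclideanSpace ℝ (Fin 3) →L[ℝ] G) :
    ‖A‖ ≤ ∑ i, ‖A (EuclideanSpace.single i 1)‖ := by
  refine ContinuousLinearMap.opNorm_le_bound _ (Finset.sum_nonneg fun i _ => norm_nonneg _)
    fun v => ?_
  -- `v = ∑ vᵢ eᵢ` -- adapted from Prior …CorridorCubicModeV12.sum_singles
  have hv : ∑ i, v i • EuclideanSpace.single i (1 : ℝ) = v := by
    have h := (EuclideanSpace.basisFun (Fin 3) ℝ).sum_repr v
    simpa only [EuclideanSpace.basisFun_repr, EuclideanSpace.basisFun_apply] using h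
  calc ‖A v‖ = ‖∑ i, v i • A (EuclideanSpace.single i 1)‖ := by
        conv_lhs => rw [← hv]
        simp only [map_sum, map_smul]
    _ ≤ ∑ i, ‖v i • A (EuclideanSpace.single i 1)‖ := norm_sum_le _ _
    _ ≤ ∑ i, ‖A (EuclideanSpace.single i 1)‖ * ‖v‖ := by
        refine Finset.sum_le_sum fun i _ => ?_
        rw [norm_smul, mul_comm]
        exact mul_le_mul_of_nonneg_left (PiLp.norm_apply_le v i) (norm_nonneg _)
    _ = (∑ i, ‖A (EuclideanSpace.single i 1)‖) * ‖v‖ := by rw [Finset.sum_mul]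

/-- The elementary estimate behind the Cauchy property of the gradients: if two linear maps
`A₁, A₂` approximate the increments `u₁ − v₁`, `u₂ − v₂` at the step `δe` up to `Mδ²`, and the
values `uⱼ`, `vⱼ` are `2η`-close, `η = εδ/32`, `2Mδ ≤ ε/8`, then `‖(A₁ − A₂)e‖ ≤ ε/4`. -/
theorem traceC1_dir_estimate {u₁ u₂ v₁ v₂ : G} {A₁ A₂ : F →L[ℝ] G} {e : F} {δ η ε : ℝ}
    (hδ : 0 < δ) (r₁ : ‖u₁ - v₁ - A₁ (δ • e)‖ ≤ M * δ ^ 2) (r₂ : ‖u₂ - v₂ - A₂ (δ • e)‖ ≤ M * δ ^ 2)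
    (d₁ : ‖u₁ - u₂‖ ≤ 2 * η) (d₂ : ‖v₁ - v₂‖ ≤ 2 * η) (hMδ : 2 * M * δ ≤ ε / 8)
    (hη : η = ε * δ / 32) : ‖(A₁ - A₂) e‖ ≤ ε / 4 := by
  have hid : δ • ((A₁ - A₂) e) =
      u₁ - u₂ - (v₁ - v₂) - (u₁ - v₁ - A₁ (δ • e)) + (u₂ - v₂ - A₂ (δ • e)) := by
    rw [sub_apply, smul_sub, ← map_smul, ← map_smul]; abel
  have h4 : ‖δ • ((A₁ - A₂) e)‖ ≤ δ * (ε / 4) := by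
    rw [hid]
    have i1 := norm_add_le (u₁ - u₂ - (v₁ - v₂) - (u₁ - v₁ - A₁ (δ • e))) (u₂ - v₂ - A₂ (δ • e))
    have i2 := norm_sub_le (u₁ - u₂ - (v₁ - v₂)) (u₁ - v₁ - A₁ (δ • e))
    have i3 := norm_sub_le (u₁ - u₂) (v₁ - v₂)
    have i4 := mul_le_mul_of_nonneg_right hMδ hδ.le
    rw [hη] at d₁ d₂
    linarith
  rw [norm_smul, Real.norm_of_nonneg hδ.le] at h4
  exact le_of_mul_le_mul_left h4 hδ

end Calculus

/-- **Gradients converge and the limit is differentiable.** Let the slices `f a : ℝ³ → ℝ³` satisfy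
the uniform Taylor estimate `‖f a (x + h) − f a x − D(f a)(x) h‖ ≤ M‖h‖²` for `‖h‖ < ρ` (eventually
along `l`) and converge pointwise on `ball x ρ` to `g`. Then `D(f a)(x)` converges along `l` to some
`L` with `HasFDerivAt g L x`: testing the Taylor estimate at `h = δeᵢ` shows that `D(f a)(x)` is
Cauchy in operator norm (`traceC1_dir_estimate`, `traceC1_opNorm_le_sum`; `ℝ³ →L ℝ³` is complete),
and the Taylor estimate passes to the limit (`M‖h‖² = o(h)`). -/
theorem traceC1_tendsto_fderiv {α : Type*} {l : Filter α} [NeBot l]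
    {f : α → EuclideanSpace ℝ (Fin 3) → EuclideanSpace ℝ (Fin 3)}
    {g : EuclideanSpace ℝ (Fin 3) → EuclideanSpace ℝ (Fin 3)} {x : EuclideanSpace ℝ (Fin 3)}
    {ρ M : ℝ} (hρ : 0 < ρ) (hM : 0 ≤ M)
    (htaylor : ∀ᶠ a in l, ∀ h ∈ ball (0 : EuclideanSpace ℝ (Fin 3)) ρ,
      ‖f a (x + h) - f a x - fderiv ℝ (f a) x h‖ ≤ M * ‖h‖ ^ 2)
    (hlim : ∀ y ∈ ball x ρ, Tendsto (fun a => f a y) l (𝓝 (g y))) :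
    ∃ L : EuclideanSpace ℝ (Fin 3) →L[ℝ] EuclideanSpace ℝ (Fin 3),
      Tendsto (fun a => fderiv ℝ (f a) x) l (𝓝 L) ∧ HasFDerivAt g L x := by
  have hx : x ∈ ball x ρ := mem_ball_self hρ
  have hmem : ∀ h ∈ ball (0 : EuclideanSpace ℝ (Fin 3)) ρ, x + h ∈ ball x ρ := fun h hh => by
    rwa [mem_ball_iff_norm, add_sub_cancel_left, ← mem_ball_zero_iff]
  -- (1) the gradients are Cauchy in operator norm
  have hcauchy : Cauchy (map (fun a => fderiv ℝ (f a) x) l) := by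
    rw [cauchy_map_iff', tendsto_uniformity_iff_dist_tendsto_zero, Metric.tendsto_nhds]
    intro ε hε
    obtain ⟨δ, hδ0, hδρ, hδε⟩ : ∃ δ : ℝ, 0 < δ ∧ δ < ρ ∧ 2 * M * δ ≤ ε / 8 := by
      have hM1 : M + 1 ≠ 0 := by positivity
      set δ₀ : ℝ := ε / (16 * (M + 1)) with hδ₀
      have hδ₀0 : 0 < δ₀ := by positivity
      have hMδ₀ : 2 * (M + 1) * δ₀ = ε / 8 := by rw [hδ₀]; field_simp; ring
      refine ⟨min (ρ / 2) δ₀, lt_min (half_pos hρ) hδ₀0,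
        (min_le_left _ _).trans_lt (half_lt_self hρ), ?_⟩
      have h1 : 2 * M * min (ρ / 2) δ₀ ≤ 2 * M * δ₀ :=
        mul_le_mul_of_nonneg_left (min_le_right _ _) (by positivity)
      linarith
    have hnorm : ∀ i : Fin 3,
        ‖(δ • EuclideanSpace.single i (1 : ℝ) : EuclideanSpace ℝ (Fin 3))‖ = δ := fun i => by
      rw [norm_smul, Real.norm_of_nonneg hδ0.le, PiLp.norm_single, norm_one, mul_one]
    have hδball : ∀ i : Fin 3, (δ • EuclideanSpace.single i (1 : ℝ) : EuclideanSpace ℝ (Fin 3)) ∈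
        ball (0 : EuclideanSpace ℝ (Fin 3)) ρ := fun i => by
      rw [mem_ball_zero_iff, hnorm]; exact hδρ
    obtain ⟨η, hη⟩ : ∃ η : ℝ, η = ε * δ / 32 := ⟨_, rfl⟩
    have hη0 : 0 < η := by rw [hη]; positivity
    have hev : ∀ᶠ a in l, (∀ h ∈ ball (0 : EuclideanSpace ℝ (Fin 3)) ρ,
        ‖f a (x + h) - f a x - fderiv ℝ (f a) x h‖ ≤ M * ‖h‖ ^ 2) ∧ dist (f a x) (g x) < η ∧
        ∀ i : Fin 3, dist (f a (x + δ • EuclideanSpace.single i 1))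
          (g (x + δ • EuclideanSpace.single i 1)) < η := by
      refine htaylor.and ((Metric.tendsto_nhds.1 (hlim x hx) η hη0).and ?_)
      exact eventually_all.2 fun i => Metric.tendsto_nhds.1 (hlim _ (hmem _ (hδball i))) η hη0
    filter_upwards [hev.prod_mk hev] with p hp
    obtain ⟨⟨hT1, hx1, he1⟩, ⟨hT2, hx2, he2⟩⟩ := hp
    rw [Real.dist_0_eq_abs, abs_dist, dist_eq_norm]
    show ‖fderiv ℝ (f p.1) x - fderiv ℝ (f p.2) x‖ < ε
    have hcoord : ∀ i : Fin 3,
        ‖(fderiv ℝ (f p.1) x - fderiv ℝ (f p.2) x) (EuclideanSpace.single i 1)‖ ≤ ε / 4 := by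
      intro i
      have r1 := hT1 _ (hδball i)
      have r2 := hT2 _ (hδball i)
      rw [hnorm i] at r1 r2
      refine traceC1_dir_estimate hδ0 r1 r2 ?_ ?_ hδε hη
      · rw [← dist_eq_norm]
        linarith [dist_triangle_right (f p.1 (x + δ • EuclideanSpace.single i 1))
          (f p.2 (x + δ • EuclideanSpace.single i 1)) (g (x + δ • EuclideanSpace.single i 1)),
          he1 i, he2 i]
      · rw [← dist_eq_norm]
        linarith [dist_triangle_right (f p.1 x) (f p.2 x) (g x)]
    calc ‖fderiv ℝ (f p.1) x - fderiv ℝ (f p.2) x‖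
        ≤ ∑ i, ‖(fderiv ℝ (f p.1) x - fderiv ℝ (f p.2) x) (EuclideanSpace.single i 1)‖ :=
          traceC1_opNorm_le_sum _
      _ ≤ ∑ _i : Fin 3, ε / 4 := Finset.sum_le_sum fun i _ => hcoord i
      _ < ε := by norm_num [Finset.sum_const, Finset.card_univ, Fintype.card_fin]; linarith
  -- (2) the limit, and the Taylor estimate in the limit
  obtain ⟨L, hL⟩ := cauchy_map_iff_exists_tendsto.1 hcauchy
  refine ⟨L, hL, ?_⟩
  have hbd : ∀ h ∈ ball (0 : EuclideanSpace ℝ (Fin 3)) ρ,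
      ‖g (x + h) - g x - L h‖ ≤ M * ‖h‖ ^ 2 := by
    intro h hh
    have ht : Tendsto (fun a => f a (x + h) - f a x - fderiv ℝ (f a) x h) l
        (𝓝 (g (x + h) - g x - L h)) :=
      ((hlim _ (hmem h hh)).sub (hlim x hx)).sub (hL.eval_const h)
    exact le_of_tendsto ht.norm (htaylor.mono fun a ha => ha h hh)
  refine hasFDerivAt_iff_isLittleO_nhds_zero.2 ?_
  refine (Asymptotics.IsBigO.of_bound M ?_).trans_isLittleO
    (Asymptotics.isLittleO_norm_pow_id one_lt_two)
  filter_upwards [ball_mem_nhds (0 : EuclideanSpace ℝ (Fin 3)) hρ] with h hh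
  rw [norm_pow, norm_norm]
  exact hbd h hh

section Slices

variable {V : ℝ → EuclideanSpace ℝ (Fin 3) → EuclideanSpace ℝ (Fin 3)} {C C₀ K₂ : ℝ}

/-- **Pineau–Vicol derivative bounds for the slices** (Lemma 7.1 with `n = 1, 2`, the classical
pressure being supplied by `exists_isClassicalNSSolutionOn_Iio_of_isTypeIAncientMild`):
`‖DV(t)(y)‖ ≤ K₁ max(‖y‖, √(−t))⁻²` and `‖D²V(t)(y)‖ ≤ K₂ max(‖y‖, √(−t))⁻³` for all `t < 0`
and all `y`. -/
theorem traceC1_slice_bounds (hV : IsTypeIAncientMild C V) (hD : HasTypeIDecay C₀ V) :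
    ∃ K₁ K₂ : ℝ, 0 ≤ K₁ ∧ 0 ≤ K₂ ∧ ∀ t < 0, ∀ y,
      ‖fderiv ℝ (V t) y‖ ≤ K₁ * (max ‖y‖ (Real.sqrt (-t)))⁻¹ ^ 2 ∧
      ‖iteratedFDeriv ℝ 2 (V t) y‖ ≤ K₂ * (max ‖y‖ (Real.sqrt (-t)))⁻¹ ^ 3 := by
  obtain ⟨p, hp⟩ := exists_isClassicalNSSolutionOn_Iio_of_isTypeIAncientMild hV
  obtain ⟨K₁, hK₁, h₁⟩ := PineauVicol2026.exists_forall_iteratedFDeriv_le_of_typeI 1 C₀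
  obtain ⟨K₂, hK₂, h₂⟩ := PineauVicol2026.exists_forall_iteratedFDeriv_le_of_typeI 2 C₀
  refine ⟨K₁, K₂, hK₁, hK₂, fun t ht y => ⟨?_, h₂ V p hp (fun t ht y => hD t ht y) t ht y⟩⟩
  rw [← norm_iteratedFDeriv_zero (𝕜 := ℝ) (f := fderiv ℝ (V t)), norm_iteratedFDeriv_fderiv]
  exact h₁ V p hp (fun t ht y => hD t ht y) t ht y

/-- **Local bounds on `B = ball x₀ (‖x₀‖/2)`, `x₀ ≠ 0`.** Every `y ∈ B` has `‖x₀‖/2 < ‖y‖`; with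
`M = K₂ (‖x₀‖/2)⁻³` the slice gradients are `M`-Lipschitz on `B` and the slices obey the Taylor
estimate `‖V(t,z) − V(t,y) − DV(t,y)(z − y)‖ ≤ M‖z − y‖²` on `B`, uniformly in `t < 0`. -/
theorem traceC1_local (hV : IsTypeIAncientMild C V)
    (hK : ∀ t < 0, ∀ y, ‖iteratedFDeriv ℝ 2 (V t) y‖ ≤ K₂ * (max ‖y‖ (Real.sqrt (-t)))⁻¹ ^ 3)
    (hK₂ : 0 ≤ K₂) {x₀ : EuclideanSpace ℝ (Fin 3)} (hx₀ : x₀ ≠ 0) :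
    (∀ y ∈ ball x₀ (‖x₀‖ / 2), ‖x₀‖ / 2 < ‖y‖) ∧
    (∀ t < 0, ∀ y ∈ ball x₀ (‖x₀‖ / 2), ∀ z ∈ ball x₀ (‖x₀‖ / 2),
      ‖fderiv ℝ (V t) z - fderiv ℝ (V t) y‖ ≤ K₂ * (‖x₀‖ / 2)⁻¹ ^ 3 * ‖z - y‖) ∧
    (∀ t < 0, ∀ y ∈ ball x₀ (‖x₀‖ / 2), ∀ z ∈ ball x₀ (‖x₀‖ / 2),
      ‖V t z - V t y - fderiv ℝ (V t) y (z - y)‖ ≤ K₂ * (‖x₀‖ / 2)⁻¹ ^ 3 * ‖z - y‖ ^ 2) := by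
  have hρ : 0 < ‖x₀‖ / 2 := half_pos (norm_pos_iff.2 hx₀)
  have hball : ∀ y ∈ ball x₀ (‖x₀‖ / 2), ‖x₀‖ / 2 < ‖y‖ := fun y hy => by
    have h1 := norm_sub_norm_le x₀ y
    rw [norm_sub_rev] at h1
    rw [mem_ball_iff_norm] at hy
    linarith
  have hD2 : ∀ t < 0, ∀ y ∈ ball x₀ (‖x₀‖ / 2),
      ‖iteratedFDeriv ℝ 2 (V t) y‖ ≤ K₂ * (‖x₀‖ / 2)⁻¹ ^ 3 := by
    intro t ht y hy
    refine (hK t ht y).trans ?_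
    have := inv_anti₀ hρ ((hball y hy).le.trans (le_max_left ‖y‖ (Real.sqrt (-t))))
    gcongr
  have h2 : ∀ t < 0, ContDiff ℝ 2 (V t) := fun t ht => contDiff_infty.1 (hV.contDiff_slice ht) 2
  exact ⟨hball, fun t ht y hy z hz =>
    traceC1_norm_fderiv_sub_le (convex_ball _ _) (h2 t ht) (hD2 t ht) hy hz,
    fun t ht y hy z hz => traceC1_taylor (convex_ball _ _) (h2 t ht) (hD2 t ht) hy hz⟩

end Slices

/-- **Stub `stub_traceC1` (N29): the scar is `C¹` off the origin and the velocity gradients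
converge.** For a Type-I ancient mild field `V` in the Oseen gauge with `HasTypeIDecay C₀ V` and
pointwise trace `V₀` off the origin: `V₀` is differentiable on `ℝ³ ∖ {0}` with continuous
derivative there, `DV(t,x) → DV₀(x)` and `curl V(t,x) → curl V₀(x)` as `t ↑ 0` for every `x ≠ 0`,
and `‖x‖² ‖DV₀(x)‖ ≤ K`. Assembly of `traceC1_slice_bounds`, `traceC1_local`,
`traceC1_tendsto_fderiv` (limit `L x` of the gradients with `HasFDerivAt V₀ (L x) x`), the Lipschitz
bound of `L` (limit of the uniform Lipschitz bounds of `DV(t)`), `curl_eq_curlCLM`, and the limit of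
`‖DV(t,x)‖ ≤ K₁‖x‖⁻²`. -/
theorem stub_traceC1 :
    ∀ (V : ℝ → EuclideanSpace ℝ (Fin 3) → EuclideanSpace ℝ (Fin 3)) (C C₀ : ℝ)
      (V₀ : EuclideanSpace ℝ (Fin 3) → EuclideanSpace ℝ (Fin 3)),
      IsTypeIAncientMild C V → HasTypeIDecay C₀ V →
      (∀ x, x ≠ 0 → Tendsto (fun t => V t x) (𝓝[<] 0) (𝓝 (V₀ x))) →
      DifferentiableOn ℝ V₀ {x | x ≠ 0} ∧ ContinuousOn (fderiv ℝ V₀) {x | x ≠ 0} ∧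
      (∀ x, x ≠ 0 → Tendsto (fun t => fderiv ℝ (V t) x) (𝓝[<] 0) (𝓝 (fderiv ℝ V₀ x))) ∧
      (∀ x, x ≠ 0 → Tendsto (fun t => curl (V t) x) (𝓝[<] 0) (𝓝 (curl V₀ x))) ∧
      (∃ K : ℝ, ∀ x, ‖x‖ ^ 2 * ‖fderiv ℝ V₀ x‖ ≤ K) := by
  intro V C C₀ V₀ hV hD hT
  obtain ⟨K₁, K₂, hK₁, hK₂, hK⟩ := traceC1_slice_bounds hV hD
  -- Step 1: the gradients converge at every `x ≠ 0`, and `V₀` is differentiable there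
  have key : ∀ x : EuclideanSpace ℝ (Fin 3), x ≠ 0 →
      ∃ L : EuclideanSpace ℝ (Fin 3) →L[ℝ] EuclideanSpace ℝ (Fin 3),
        Tendsto (fun t => fderiv ℝ (V t) x) (𝓝[<] 0) (𝓝 L) ∧ HasFDerivAt V₀ L x := by
    intro x hx
    obtain ⟨hball, -, htaylor⟩ := traceC1_local hV (fun t ht y => (hK t ht y).2) hK₂ hx
    have hρ : 0 < ‖x‖ / 2 := half_pos (norm_pos_iff.2 hx)
    refine traceC1_tendsto_fderiv hρ (by positivity : 0 ≤ K₂ * (‖x‖ / 2)⁻¹ ^ 3) ?_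
      fun y hy => hT y ?_
    · filter_upwards [self_mem_nhdsWithin] with t ht h hh
      have hxh : x + h ∈ ball x (‖x‖ / 2) := by
        rwa [mem_ball_iff_norm, add_sub_cancel_left, ← mem_ball_zero_iff]
      simpa only [add_sub_cancel_left] using htaylor t ht x (mem_ball_self hρ) (x + h) hxh
    · intro h0
      have := hball y hy
      rw [h0, norm_zero] at this
      linarith
  choose! L hLt hLd using key
  have hfd : ∀ x, x ≠ 0 → fderiv ℝ V₀ x = L x := fun x hx => (hLd x hx).fderiv
  have h3 : ∀ x, x ≠ 0 → Tendsto (fun t => fderiv ℝ (V t) x) (𝓝[<] 0) (𝓝 (fderiv ℝ V₀ x)) :=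
    fun x hx => by rw [hfd x hx]; exact hLt x hx
  refine ⟨fun x hx => (hLd x hx).differentiableAt.differentiableWithinAt, fun x₀ hx₀ => ?_, h3,
    fun x hx => ?_, ⟨K₁, fun x => ?_⟩⟩
  · -- Step 2: continuity of `DV₀` off the origin (uniform Lipschitz bounds pass to the limit)
    obtain ⟨hball, hlip, -⟩ := traceC1_local hV (fun t ht y => (hK t ht y).2) hK₂ hx₀
    have hρ : 0 < ‖x₀‖ / 2 := half_pos (norm_pos_iff.2 hx₀)
    have hne : ∀ y ∈ ball x₀ (‖x₀‖ / 2), y ≠ 0 := fun y hy h0 => by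
      have := hball y hy
      rw [h0, norm_zero] at this
      linarith
    have hL0 : ∀ y ∈ ball x₀ (‖x₀‖ / 2),
        ‖fderiv ℝ V₀ y - fderiv ℝ V₀ x₀‖ ≤ K₂ * (‖x₀‖ / 2)⁻¹ ^ 3 * ‖y - x₀‖ := fun y hy =>
      le_of_tendsto ((h3 y (hne y hy)).sub (h3 x₀ hx₀)).norm (by
        filter_upwards [self_mem_nhdsWithin] with t ht
        exact hlip t ht x₀ (mem_ball_self hρ) y hy)
    refine ContinuousAt.continuousWithinAt ?_
    rw [ContinuousAt, tendsto_iff_norm_sub_tendsto_zero]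
    refine squeeze_zero' (Eventually.of_forall fun y => norm_nonneg _)
      (g := fun y => K₂ * (‖x₀‖ / 2)⁻¹ ^ 3 * ‖y - x₀‖) ?_ ?_
    · filter_upwards [ball_mem_nhds x₀ hρ] with y hy using hL0 y hy
    · simpa using (tendsto_const_nhds (x := K₂ * (‖x₀‖ / 2)⁻¹ ^ 3)).mul (tendsto_norm_sub_self x₀)
  · -- Step 3: the vorticities converge (`curl = curlCLM ∘ D`)
    simp_rw [curl_eq_curlCLM]
    exact (curlCLM.continuous.tendsto _).comp (h3 x hx)
  · -- Step 4: the bound `‖x‖² ‖DV₀ x‖ ≤ K₁`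
    by_cases hx : x = 0
    · rw [hx, norm_zero]
      simpa using hK₁
    have hxn : 0 < ‖x‖ := norm_pos_iff.2 hx
    have hb : ‖fderiv ℝ V₀ x‖ ≤ K₁ * ‖x‖⁻¹ ^ 2 := by
      refine le_of_tendsto (h3 x hx).norm ?_
      filter_upwards [self_mem_nhdsWithin] with t ht
      refine (hK t ht x).1.trans ?_
      have := inv_anti₀ hxn (le_max_left ‖x‖ (Real.sqrt (-t)))
      gcongr
    calc ‖x‖ ^ 2 * ‖fderiv ℝ V₀ x‖ ≤ ‖x‖ ^ 2 * (K₁ * ‖x‖⁻¹ ^ 2) := by gcongr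
      _ = K₁ := by rw [inv_pow]; field_simp

end Summit.NavierStokesRegularity.NavierStokesRegularity.Theorems.PolyhedralDssProfileExists.PolyhedralCell
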